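import Summits.BirchSwinnertonDyer.BirchSwinnertonDyer.Theorems.GenusKolyvaginAtTwoGenusPrimitiveSupplyAtTwoTwistSelmerStrictInherit
import HarnessLib

/-!
# Route `GenusKolyvaginAtTwo`, crux 23491 `GenusDeepSupplyAtTwoNegDiscNarrow`, `#Sel₂(E) = 1` cell: THE TWIN IS NOT STRICT AT THE TWISTING
# PRIME — the Selmer half of Claim B of the LEAD's depth-zero reduction criterion (memo `DEPTH-ZERO-REDUCTION-CRITERION-g21.md` §2)

Seat `bsd-line-gk2-p5` g34 (cell `bsd-f1-sign2`, WIDTH-5 attach), `--supports stmt-BirchSwinnertonDyer-23491 --as helper`.  THEOREMS ONLY (no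
definition, no named fact, no `sorry`); UNCONDITIONAL.  **BSD is NOT proved by this file and no item is closed by it.**

Frame (the `#Sel₂(E) = 1` cell of the Δ<0 supply at a PRIME Heegner field, LEAD instrument I1): `W/ℚ` globally minimal with `Δ_W < 0`, `K`
imaginary quadratic with `d_K = −ℓ` (`ℓ` prime), Heegner for `N_W`, `2` split in `K`, `Wd` an elliptic model of the twin `W^{(d_K)}`.
gk2-p4 g9's §29 (`GenusKolyTwistLocal.natCard_selmerGroup_dvd_twin_of_le_strictLocalKer`) is Mazur–Rubin Cor. 3.4 (i), STRICT case,
divisibility half, for the pair `(W, Wd)`: `Sel₂(W)` strict at `ℓ` ⟹ `#Sel₂(W) ∣ #Sel₂(Wd)`.  Here the SAME kernel theorem (§28, congruent pair with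
the place menu, nothing assumed at `ℓ`) is run for the pair `(Wd, W)` — the twist relation read backwards, `W ≅ Wd^{(d_K)}`, the place menu being
symmetric in the pair:

* §1 `natCard_selmerGroup_twin_dvd_of_twin_le_strictLocalKer` — `Sel₂(Wd)` strict at `ℓ` ⟹ `#Sel₂(Wd) ∣ #Sel₂(W)`.
* §2 **`not_twin_le_strictLocalKer_of_natCard_selmerGroup_eq_one`** — on the cell (`#Sel₂(W) = 1`, `#Sel₂(Wd) = 2`): `Sel₂(Wd)` is NOT strict
  at `ℓ`; `exists_twin_selmer_localization_ne_zero_of_natCard_selmerGroup_eq_one` — the non-trivial class of `Sel₂(Wd) ≅ ℤ/2` has NON-ZERO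
  localisation at the place over `ℓ` (so it spans `H¹_f(ℚ_ℓ, Wd[2]) ≅ 𝔽₂`, Mazur–Rubin's `V_T = H¹_f`).

READING (Claim B, Selmer half).  On this cell `Sel₂(Wd) = Wd(ℚ)/2Wd(ℚ)` (`Ш(Wd)[2] = 0`, rank `1`, no rational `2`-torsion) is spanned by the
Kummer class of a generator `z`; when `M₀ = 0` the twin Heegner point is an odd multiple of `z` modulo torsion, so its Kummer class is that
generator, and §2 says it is NOT `2`-divisible in `Wd(ℚ_ℓ)`: the LEAD's «`z` reduces to the SINGULAR point at the twisting prime» once the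
Kummer-theoretic reading at the additive prime `ℓ` of `Wd` (`loc_ℓ κ(z) = 0 ⟺ z ∈ 2Wd(ℚ_ℓ) ⟺ red_λ(ψ z) = Õ`, `E₁(K_λ)` uniquely `2`-divisible) is
supplied — that local reading is NOT in this file.  Converse bookkeeping of p762355 (`DepthZero.K1_of_reductionBit`, R₁ → K₁).

References: [MazurRubin2010] B. Mazur, K. Rubin, Invent. Math. 181 (2010) = arXiv:0904.3709, Def. 3.1, Lemma 2.10, Prop. 3.3, Cor. 3.4 (i);
[Kramer1981] Prop. 3; [GrossLMS1991] §1 (p. 235), §5 Prop. 5.3; [SilvermanAEC2009] X.2 Prop. 2.4, X.5 Cor. 5.4.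
-/

set_option linter.dupNamespace false -- `Summit.<P>.<Sub>` repeats `BirchSwinnertonDyer` (D-0017)
set_option autoImplicit false

noncomputable section

open scoped Classical ContRepresentation

namespace Summit.BirchSwinnertonDyer.BirchSwinnertonDyer.Theorems.GenusSupplyNarrow.TwinStrict

open WeierstrassCurve Field NumberField IsDedekindDomain Function
open Literature.NumberTheory.EllipticCurves Literature.NumberTheory.GaloisRepresentations
open Literature.NumberTheory.GaloisCohomology
open Rat.HeightOneSpectrum (primesEquiv natGenerator)
open Summit.BirchSwinnertonDyer.BirchSwinnertonDyer.Theorems.GenusKolyTwistLocal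

/-! ## §0 The twist relation read backwards -/

/-- **`Wd ≅ W^{(d)} ⟹ W ≅ Wd^{(d)}`** (`d ≠ 0`): `Wd^{(d)} = (C • W^{(d)})^{(d)} ≅ (W^{(d)})^{(d)} = W^{(d²)} ≅ W^{(1)} ≅ W`.  Private copy of
`TwoAdicTwistConverse.exists_variableChange_quadraticTwist_symm` (same proof; kept private to avoid a heavy import).
[cite: SilvermanAEC2009, X.2 Prop. 2.4 and X.5 Cor. 5.4] -/
private theorem exists_variableChange_quadraticTwist_symm (W : WeierstrassCurve ℚ) {d : ℚ} (hd : d ≠ 0) {A : WeierstrassCurve ℚ}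
    {C : VariableChange ℚ} (hA : C • W.quadraticTwist d = A) : ∃ C' : VariableChange ℚ, C' • A.quadraticTwist d = W := by
  obtain ⟨C₁, hC₁⟩ := W.exists_variableChange_quadraticTwist_one
  obtain ⟨C₂, hC₂⟩ := W.exists_variableChange_quadraticTwist_mul_sq (1 : ℚ) d hd
  have h3 : A.quadraticTwist d = (⟨C.u, d * C.r, 0, 0⟩ : VariableChange ℚ) • (C₂ • C₁ • W) := by
    rw [← hA, quadraticTwist_smul, quadraticTwist_quadraticTwist, hC₁, hC₂]
    congr 1
    ring
  have h4 : A.quadraticTwist d = ((⟨C.u, d * C.r, 0, 0⟩ : VariableChange ℚ) * C₂ * C₁) • W := by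
    rw [h3, mul_smul, mul_smul]
  refine ⟨((⟨C.u, d * C.r, 0, 0⟩ : VariableChange ℚ) * C₂ * C₁)⁻¹, ?_⟩
  rw [h4, inv_smul_smul]

/-! ## §1 Strict classes of the TWIN are inherited by `W` -/

/-- **MAZUR–RUBIN COR. 3.4 (i), STRICT CASE, DIVISIBILITY HALF, FOR THE PAIR `(Wd, W)` — UNCONDITIONAL.**  `W/ℚ` globally minimal elliptic
with `Δ_W < 0`, `K` imaginary quadratic with `d_K = −ℓ` (`ℓ` prime), Heegner for `N_W`, `2` split in `K`, `Wd` an elliptic model of `W^{(d_K)}`.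
IF `Sel₂(Wd)` is strict at `ℓ` (`Sel₂(Wd) ≤ MazurRubin2010.strictLocalKer Wd ℚ_ℓ 2`), THEN `#Sel₂(Wd) ∣ #Sel₂(W)`.  Proof: §28
(`natCard_selmerGroup_dvd_twist_of_places_of_forall_localization_eq_zero`) for the base curve `Wd` and its twist `W ≅ Wd^{(d_K)}` (§0), with
the place menu of §25 (`twist_place_menu_finite_rat` / `twist_place_menu_infinite_rat`), which is symmetric in the pair; nothing is assumed at `ℓ`.
[cite: MazurRubin2010, Prop. 3.3, Cor. 3.4 (i), Lemma 2.10 (arXiv:0904.3709 pp. 8–10)] [cite: GrossLMS1991, §1 (p. 235)] -/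
theorem natCard_selmerGroup_twin_dvd_of_twin_le_strictLocalKer (W : WeierstrassCurve ℚ) [W.IsElliptic] [W.IsGloballyMinimal]
    {K : Type} [Field K] [NumberField K]
    (hΔ : W.Δ < 0) (hK : IsImaginaryQuadratic K)
    (hH : SatisfiesHeegnerHypothesis (W.conductorNorm ℤ) K) (h2K : ((Ideal.span {(2 : ℤ)}).primesOver (𝓞 K)).ncard = 2)
    {ℓ : ℕ} [Fact ℓ.Prime] (hd : discr K = -(ℓ : ℤ)) (Wd : WeierstrassCurve ℚ) [Wd.IsElliptic]
    (hWd : ∃ C : VariableChange ℚ, C • W.quadraticTwist (discr K : ℚ) = Wd)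
    (hs : Wd.selmerGroup 2 ≤ MazurRubin2010.strictLocalKer Wd ℚ_[ℓ] 2) :
    Nat.card (Wd.selmerGroup 2) ∣ Nat.card (W.selmerGroup 2) := by
  have hℓ : ℓ.Prime := Fact.out
  -- the place `v₀` of `ℚ` over `ℓ`
  obtain ⟨v₀, hv₀⟩ : ∃ v : HeightOneSpectrum (𝓞 ℚ), ((primesEquiv v : Nat.Primes) : ℕ) = ℓ :=
    ⟨primesEquiv.symm ⟨ℓ, hℓ⟩, by rw [Equiv.apply_symm_apply]⟩
  have hℓv₀ : (ℓ : 𝓞 ℚ) ∈ v₀.asIdeal := by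
    rw [← hv₀]
    exact Rat.HeightOneSpectrum.natCast_natGenerator_mem v₀
  obtain ⟨C, hC⟩ := hWd
  have hd0 : (discr K : ℚ) ≠ 0 := by
    rw [hd]
    push_cast
    exact neg_ne_zero.mpr (by exact_mod_cast hℓ.ne_zero)
  -- the twist relation backwards
  obtain ⟨C', hC'⟩ := exists_variableChange_quadraticTwist_symm W hd0 hC
  -- strictness of `Sel₂(Wd)` at `v₀` in the localisation currency
  have hstrict : ∀ c ∈ (Wd.kummerSelmerStructure ((2 : ℕ) : ℤ)).selmerGroup,
      galoisCohomology.localization (Wd.torsionGaloisModule ((2 : ℕ) : ℤ)) (Sum.inr v₀) 1 c = 0 := by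
    apply forall_selmer_localization_eq_zero_of_le_strictLocalKer Wd v₀
    subst hv₀
    exact hs
  -- the place menu for `(W, Wd)`, read for `(Wd, W)`
  have hfin := twist_place_menu_finite_rat W hK.1 hH h2K hℓ hd hℓv₀ hC
  have hinf := twist_place_menu_infinite_rat W hΔ hd0 hC
  have h := natCard_selmerGroup_dvd_twist_of_places_of_forall_localization_eq_zero Wd hd0 hC' v₀
    (fun v hv ↦ (hfin v hv).imp_right fun h ↦ h.imp (fun h' ↦ ⟨h'.1, h'.2.2, h'.2.1⟩) (fun h' ↦ ⟨h'.1, h'.2.2, h'.2.1⟩))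
    (fun w ↦ (hinf w).imp_right fun h ↦ ⟨h.2, h.1⟩) hstrict
  exact h

/-! ## §2 On the `#Sel₂(E) = 1` cell the twin is NOT strict at the twisting prime -/

/-- **CLAIM B, SELMER HALF: on the `#Sel₂(E) = 1` cell the `2`-Selmer-minimal twin is NOT strict at the twisting prime.**  `W/ℚ` globally minimal,
`Δ_W < 0`, `#Sel₂(W) = 1`; `K` imaginary quadratic with `d_K = −ℓ` (`ℓ` prime), Heegner for `N_W`, `2` split in `K`; `Wd` an elliptic model of
`W^{(d_K)}` with `#Sel₂(Wd) = 2`.  Then `¬ Sel₂(Wd) ≤ strictLocalKer Wd ℚ_ℓ 2` (else §1 would give `2 ∣ 1`).  UNCONDITIONAL.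
[cite: MazurRubin2010, Cor. 3.4 (i) (arXiv:0904.3709 p. 10)] [cite: Kramer1981, Prop. 3] -/
theorem not_twin_le_strictLocalKer_of_natCard_selmerGroup_eq_one (W : WeierstrassCurve ℚ) [W.IsElliptic] [W.IsGloballyMinimal]
    {K : Type} [Field K] [NumberField K]
    (hΔ : W.Δ < 0) (h1 : Nat.card (W.selmerGroup 2) = 1) (hK : IsImaginaryQuadratic K)
    (hH : SatisfiesHeegnerHypothesis (W.conductorNorm ℤ) K) (h2K : ((Ideal.span {(2 : ℤ)}).primesOver (𝓞 K)).ncard = 2)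
    {ℓ : ℕ} [Fact ℓ.Prime] (hd : discr K = -(ℓ : ℤ)) (Wd : WeierstrassCurve ℚ) [Wd.IsElliptic]
    (hWd : ∃ C : VariableChange ℚ, C • W.quadraticTwist (discr K : ℚ) = Wd) (hSel : Nat.card (Wd.selmerGroup 2) = 2) :
    ¬ Wd.selmerGroup 2 ≤ MazurRubin2010.strictLocalKer Wd ℚ_[ℓ] 2 := by
  intro hs
  have h := natCard_selmerGroup_twin_dvd_of_twin_le_strictLocalKer W hΔ hK hH h2K hd Wd hWd hs
  rw [hSel, h1] at h
  exact absurd (Nat.le_of_dvd one_pos h) (by norm_num)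

/-- **The non-trivial `2`-Selmer class of the twin has NON-ZERO localisation at the place over the twisting prime** (same cell as
`not_twin_le_strictLocalKer_of_natCard_selmerGroup_eq_one`; gk2-p5's `exists_selmer_localization_ne_zero_of_not_le_strictLocalKer` turns
«not strict» into a class `c ∈ Sel₂(Wd)` with `loc_v c ≠ 0` at the place `v` of `ℚ` over `ℓ`).  Since `#Sel₂(Wd) = 2`, `c` is THE non-zero
class; Mazur–Rubin's `V_{{ℓ}} = loc_ℓ Sel₂(Wd) = H¹_f(ℚ_ℓ, Wd[2])`.  UNCONDITIONAL.  [cite: MazurRubin2010, Def. 3.1, Cor. 3.4 (i)] -/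
theorem exists_twin_selmer_localization_ne_zero_of_natCard_selmerGroup_eq_one (W : WeierstrassCurve ℚ) [W.IsElliptic]
    [W.IsGloballyMinimal] {K : Type} [Field K] [NumberField K]
    (hΔ : W.Δ < 0) (h1 : Nat.card (W.selmerGroup 2) = 1) (hK : IsImaginaryQuadratic K)
    (hH : SatisfiesHeegnerHypothesis (W.conductorNorm ℤ) K) (h2K : ((Ideal.span {(2 : ℤ)}).primesOver (𝓞 K)).ncard = 2)
    {ℓ : ℕ} (hℓ : ℓ.Prime) (hd : discr K = -(ℓ : ℤ)) (Wd : WeierstrassCurve ℚ) [Wd.IsElliptic]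
    (hWd : ∃ C : VariableChange ℚ, C • W.quadraticTwist (discr K : ℚ) = Wd) (hSel : Nat.card (Wd.selmerGroup 2) = 2)
    (v : HeightOneSpectrum (𝓞 ℚ)) (hv : (ℓ : 𝓞 ℚ) ∈ v.asIdeal) :
    ∃ c ∈ (Wd.kummerSelmerStructure ((2 : ℕ) : ℤ)).selmerGroup,
      galoisCohomology.localization (Wd.torsionGaloisModule ((2 : ℕ) : ℤ)) (Sum.inr v) 1 c ≠ 0 := by
  haveI : Fact ℓ.Prime := ⟨hℓ⟩
  have hns := not_twin_le_strictLocalKer_of_natCard_selmerGroup_eq_one W hΔ h1 hK hH h2K hd Wd hWd hSel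
  -- `v` IS the place over `ℓ`
  obtain ⟨v₀, hv₀⟩ : ∃ v : HeightOneSpectrum (𝓞 ℚ), ((primesEquiv v : Nat.Primes) : ℕ) = ℓ :=
    ⟨primesEquiv.symm ⟨ℓ, hℓ⟩, by rw [Equiv.apply_symm_apply]⟩
  have hℓv₀ : (ℓ : 𝓞 ℚ) ∈ v₀.asIdeal := by
    rw [← hv₀]
    exact Rat.HeightOneSpectrum.natCast_natGenerator_mem v₀
  have hvv : v = v₀ := Literature.NumberTheory.EllipticCurves.HeightOneSpectrum.eq_of_natCast_mem_rat hℓ hv hℓv₀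
  subst hvv
  apply exists_selmer_localization_ne_zero_of_not_le_strictLocalKer Wd v
  subst hv₀
  exact hns

end Summit.BirchSwinnertonDyer.BirchSwinnertonDyer.Theorems.GenusSupplyNarrow.TwinStrict

end
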